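import Literature.MathematicalPhysics.QuantumLattice.GappedParamagnetExactSolution
import HarnessLib

/-!
# Barrier: relative-octave (`√h`, Goldstone-exponent) extrapolation of the sourced order parameter is
# stiffness-blind — it certifies order on the exactly solvable gapped paramagnet

Barrier catalogue `Literature/Barriers/HubbardSuperconductivity/` (D-0021), entry
`SqrtFieldExtrapolationFalsePositive`; companion of `FiniteFieldResponseWithoutLRO` (same witness object,
`GappedParamagnet.paramagnet N B`: `H_N = B Σ_x S^z_x`, `O = O^{(1)} = Σ_x S^x_x`, sourced Hamiltonian
`K_h = H_N − h O = GappedParamagnet.sourced N B h`).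

## Context (summit `HubbardSuperconductivity`, cell `hubbard-cq`, LADDER row PC-a "pinning-field response")

Print decides "d-wave order PRESENT/ABSENT" for the doped Hubbard model by computing the response `m(h)` to a
pairing (pinning) field at a few field strengths `h` and EXTRAPOLATING `h → 0⁺` with a fitted form (linear /
quadratic fits: Qin et al. 2020 §III; Xu et al. 2024 §III.B).  The cell's card `ktx-relative-octave-extrapolation`
proposed the certified version of this lever: bracket the thermodynamic-limit response stair `F(h)` by
CERTIFIED energy chords `S(a, b) := (e(a) − e(b))/(b − a) ∈ [F(a⁺), F(b⁻)]` of the sourced ground-energy density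
`e(h)` (concavity), and extrapolate with the Goldstone exponent `α = ½` of a `d = 2+1` broken `U(1)`
(`m(h) = m* + c√h + O(h)`): with `g_α := 1/(2^α − 1)`, `g_{1/2} = 1 + √2`, the rule reads
  chord form  `C_½(hₐ) := (1 + g)·S(hₐ/2, hₐ) − g·S(2hₐ, 3hₐ)`  ("≤ m*" under the declared octave-regularity
  hypothesis GR),   point form  `P_½(hₐ) := (1 + g)·m(hₐ) − g·m(2hₐ)`  (= Richardson extrapolation, exponent ½).
The card pre-registered the kill test "rule ≤ 0 identically on the gapped paramagnet".  Both cell critics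
(critic-1, verdict 2026-08-26T17:49Z; pc-critic-3, second opinion 18:37Z) KILLED it on exactly that test in the
NEAR-CRITICAL regime `B < hₐ`: there the paramagnet's exact response `m(h) = h/(2√(B² + h²))` is nearly
saturated on all four fields while `m* = 0`, and `C_½ > 0` iff `B < 0.806·hₐ`, `P_½ > 0` iff `B < √2·hₐ`,
`C_½ → ½ = ō` (full saturation) as `B/hₐ → 0` — for EVERY exponent (pc-critic-3 §B′).  This file is the tree
twin of those two verdicts: negative knowledge the gate can cite the next time a `√h`/octave rule is carded.

## Content

§1 (imported, `Literature/MathematicalPhysics/QuantumLattice/GappedParamagnetExactSolution.lean`, namespace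
`…QuantumLattice.GappedParamagnetExact`) EXACT SOLUTION of the sourced paramagnet: for `B > 0`, every `h`, every
`N`, every variational ground state `Φ` of `K_h` has energy EXACTLY `N·e(B,h)`, `e(B,h) = energyDensity B h =
−½√(B² + h²)` (sharp operator bound `k_x² = ¼(B²+h²)` + tilted product state) and response EXACTLY `N·m(B,h)`,
`m(B,h) = response B h = h/(2√(B² + h²))` (Hellmann–Feynman by Fermat's theorem on the variational inequality);
`0 ≤ m ≤ h/(2B)`, `m → 0` (`m* = 0`), `m < ½`; chord sandwich `m(a) ≤ S(a,b) ≤ m(b)`.  No volume dependence at all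
(`lim_N`, `liminf_N` are identities), no LRO and a unique gapped symmetric ground state (`paramagnet_profile`).

§2 THE RULE ON THE EXACT DATA (`OctaveExtrapolation.chordRule g e hₐ`, `.pointRule g m hₐ`, generic in the
profile; `goldstoneHalf = 1 + √2 = 1/(√2 − 1)`):
* `chordRule_ge_of_nonneg` (EVERY exponent, `g ≥ 0`): `C_g(hₐ) ≥ ½ − (1 + g)·B/hₐ` for all `B, hₐ > 0` — from
  the two chord–response sandwiches `m(a) ≤ S(a,b) ≤ m(b)` (`response_le_chord`, `chord_le_response`) and
  `m(hₐ/2) ≥ ½(1 − 2B/hₐ)`, `m < ½`; so the rule "certifies" `m* → ½ = ō` (FULL saturation) as `B/hₐ → 0` on a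
  system with `m* = 0`, whatever the exponent (pc-critic-3 §B′ "no exponent repairs it"); `chordRule_pos_of_nonneg`:
  `C_g > 0` for `B < hₐ/(2(1+g))`; `chordRule_ge`: the `α = ½` case `C_½ ≥ ½ − (2 + √2)·B/hₐ`;
* `chordRule_pos`: `C_½(hₐ) > 0` for every `0 < B < hₐ/2` (scale-free; uses the exact `m(hₐ/2)`);
* `chordRule_one_two`: the verdict-table row `B/hₐ = ½` exactly: `C_½ > 1/5` at `(B, hₐ) = (1, 2)` (`+0.220`);
* `pointRule_pos_iff_sq` (every `g ≥ 0`): `P_g(hₐ) > 0 ↔ 4g²(B²+hₐ²) < (1+g)²(B²+4hₐ²)`; `pointRule_pos_iff`: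
  `P_½(hₐ) > 0 ↔ B < √2·hₐ` (the exact threshold of pc-critic-3 §B).
§3 HEADLINE `SqrtFieldExtrapolationFalsePositive` (+ `_holds`, + the existential corollary
`sqrtExtrapolation_false_positive`): for every `hₐ > 0` and every `0 < B < hₐ/2`, for EVERY `N ≥ 1`, the
Koma–Tasaki `U(1)` system `paramagnet N B` (volume-independent constants `r = 2`, `o = ½`, `h̄ = B/2`, on-site
supports) has a unique gapped symmetric ground state without LRO, sourced ground states at every field whose
energy and response are EXACTLY `N·e(B,h)` and `N·m(B,h)` with `0 ≤ m(B,h) ≤ h/(2B)` (`m* = 0`), and yet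
`C_½(hₐ) > 0`, `C_½(hₐ) ≥ ½ − (2+√2)B/hₐ` and `P_½(hₐ) > 0` on these exact data.

technique_class: pinning-field symmetry-breaking-field finite-field-response quasi-average extrapolation-in-field Richardson-extrapolation Goldstone-exponent scaling-hypothesis-extrapolation sourced-chord-concavity relative-octave-modulus gapped-paramagnet Koma-Tasaki-converse
blocks: every certificate mechanism / route step of the shape "certified sourced data (energy chords or one-point responses of `H − hO`) at finitely many fields `h ≥ h_min > 0`, combined by an EXTRAPOLATION RULE whose `h → 0⁺` input is a RELATIVE regularity hypothesis on the response stair (octave regularity `F(hₐ) − F(h) ≤ κ g_α [F(2hₐ) − F(hₐ)]`, Goldstone/`√h` scaling continued from the last certified octave, Richardson extrapolation with exponent `α`, polynomial fits) ⇒ FLOOR on the quasi-average `m*` or on LRO", as a transfer principle over any class of `U(1)`-symmetric systems containing the gapped paramagnet (translation-invariant, on-site, volume-independent, unique gapped symmetric ground state) — cell `hubbard-cq` census (23), pc-critic-3 KILL-KIT v0.2 W10 (v0.1: W9); the rule is sound only on states where its hypothesis holds, and certified data above `hₐ/2` cannot tell whether it does (flat octaves = ordered OR near-critical gapped).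
because: on `paramagnet N B` with `0 < B < hₐ/2` the sourced energy density and response are exactly `−½√(B²+h²)` and `h/(2√(B²+h²))` at every volume, `m* = 0`, no LRO, and the `α = ½` octave rule evaluates to `C_½(hₐ) > 0`, `≥ ½ − (2+√2)B/hₐ → ō`, `P_½(hₐ) > 0` (iff `B < √2 hₐ`) — theorems `SqrtFieldExtrapolationFalsePositive_holds`, `chordRule_pos`, `chordRule_ge`, `pointRule_pos_iff` below; relative octave rules do not remove the absolute field scale (a symmetric-phase uniform-mode gap `B`), they hide it in the domain of validity of the hypothesis [cite: KomaTasaki1994, §2.5] (one-sidedness of the quasi-average: finite-field data bound the non-decreasing `m(h)` and hence `m*` only from above).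
evasions_known: (i) an ABSOLUTE certified input excluding a symmetric-phase gap `B ∈ (0, c·hₐ)` of the uniform order-parameter mode (`c = 0.806` chord form, `√2` point form) — an absence-side object no energy/moment window supplies (`StiffnessFloorInvisibleToSpectralMoments`); (ii) a certified modulus of continuity / susceptibility majorant of `m(h)` at `0⁺` (floor-strength input, no producer); (iii) direct LRO proofs (reflection positivity, infrared bounds [cite: KennedyLiebShastry1988]) used with the proved direction LRO ⇒ response [cite: KomaTasaki1994, Corollary 2.9]; (iv) report extrapolated numbers in an "extrapolated" confidence class, never as certified floors (cell ruling, 2026-08-26; print's protocol [cite: QinEtAl2020, §III] [cite: XuEtAl2024, §III.B] is a fit, not a bound).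
scope_caveats: refutes the RULE as a transfer principle (and records its exact behaviour on one solvable family); says nothing about the Hubbard model at given `(U, n, t′)`, where `m(h)` may well obey a `√h` law — that is then a model-specific theorem to be proved with model-specific input; the ordered-side POWER defect of the same rule (pc-critic-3 §C: internal-field scale) is a [float] mean-field statement and is not formalised; thresholds `0.806` (chord form, all `B/hₐ`) are numerics of the critics — formalised here: `B < hₐ/2` (chord form, sufficient), `B/hₐ = ½` exactly, and the exact point-form threshold `√2`.
status: established (theorems below; exact paramagnet [folklore]; context [cite: KomaTasaki1994, §1, §2.5]).

## References

* T. Koma, H. Tasaki, J. Stat. Phys. 76 (1994) 745–803, arXiv:cond-mat/9708132 (`KomaTasaki1994`): §1 (order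
  parameters under a symmetry-breaking field), Cor. 2.9 (LRO ⇒ response), §2.5 (one-sidedness; Conj. 2.10).
* M. Qin et al., Phys. Rev. X 10 (2020) 031016 (`QinEtAl2020`), §III: pairing-pinning-field protocol, linear
  extrapolation `h_p → 0`.  H. Xu et al., Science 384 (2024) eadh7691 (`XuEtAl2024`), §III.B: same protocol.
* C. P. Hofmann, arXiv:1509.01720, eq. p. 12: `m(H_s) = m* + (N−1) m*^{3/2}/(8πF³) √H_s + O(H_s)` in `d = 2+1`
  (the origin of `α = ½`; context only, nothing of it is used).
* T. Kennedy, E. H. Lieb, B. S. Shastry, J. Stat. Phys. 53 (1988) 1019 (`KennedyLiebShastry1988`): evasion (iii).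
* Cell `hubbard-cq` files (not citable): `cards/card-ktx-relative-octave-extrapolation.md`,
  `critic/verdict-ktx-relative-octave-extrapolation.md` (critic-1), `…-pc3.md` (pc-critic-3).
-/

noncomputable section

open Complex Finset
open scoped InnerProductSpace ComplexConjugate

namespace Literature.Barriers.HubbardSuperconductivity


/-! ### §2  The relative-octave extrapolation rule and its values on the exact paramagnet data -/

namespace OctaveExtrapolation

open Literature.MathematicalPhysics.QuantumLattice.GappedParamagnetExact

/-- The Goldstone constant of the `α = ½` rule, `g_{1/2} = 1/(2^{1/2} − 1) = 1 + √2` (`d = 2+1` broken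
`U(1)`: `m(h) = m* + c√h + …`). [folklore] -/
def goldstoneHalf : ℝ := 1 + Real.sqrt 2

/-- `1/(√2 − 1) = 1 + √2`. [folklore] -/
private theorem one_div_sqrt_two_sub_one : 1 / (Real.sqrt 2 - 1) = goldstoneHalf := by
  have h2 : Real.sqrt 2 ^ 2 = 2 := Real.sq_sqrt (by norm_num)
  have hgt : 1 < Real.sqrt 2 := by
    rw [show (1 : ℝ) = Real.sqrt 1 by simp]
    exact Real.sqrt_lt_sqrt (by norm_num) (by norm_num)
  rw [goldstoneHalf, div_eq_iff (by linarith)]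
  nlinarith [h2]

/-- **The octave rule, chord form** (cell `hubbard-cq`, card `ktx-relative-octave-extrapolation`, kill test k2 as
run by the critics): from a sourced energy-density profile `e` and a field `hₐ`,
`C_g(hₐ) := (1 + g)·S(hₐ/2, hₐ) − g·S(2hₐ, 3hₐ)` with `S(a,b) = (e(a) − e(b))/(b − a)`; under the card's
octave-regularity hypothesis it would be a floor on `m*`. [folklore] -/
def chordRule (g : ℝ) (e : ℝ → ℝ) (hₐ : ℝ) : ℝ :=
  (1 + g) * ((e (hₐ / 2) - e hₐ) / (hₐ - hₐ / 2)) - g * ((e (2 * hₐ) - e (3 * hₐ)) / (3 * hₐ - 2 * hₐ))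

/-- **The octave rule, point form** `P_g(hₐ) := (1 + g)·m(hₐ) − g·m(2hₐ)` on a response profile `m`
(Richardson extrapolation of `(m(hₐ), m(2hₐ))` with exponent `α`, `g = 1/(2^α − 1)`). [folklore] -/
def pointRule (g : ℝ) (m : ℝ → ℝ) (hₐ : ℝ) : ℝ := (1 + g) * m hₐ - g * m (2 * hₐ)

/-- The chord form on the paramagnet is built from the two chords `S(hₐ/2, hₐ)`, `S(2hₐ, 3hₐ)`. [folklore] -/
private theorem chordRule_energyDensity (g B hₐ : ℝ) :
    chordRule g (energyDensity B) hₐ = (1 + g) * chord B (hₐ / 2) hₐ - g * chord B (2 * hₐ) (3 * hₐ) := by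
  simp only [chordRule, chord]

/-- Bounds on `√2`: `1.41421 < √2 < 1.41422`. [folklore] -/
private theorem sqrt_two_bounds : (1.41421 : ℝ) < Real.sqrt 2 ∧ Real.sqrt 2 < 1.41422 := by
  constructor
  · rw [Real.lt_sqrt (by norm_num)]; norm_num
  · rw [Real.sqrt_lt' (by norm_num)]; norm_num

/-- **The rule reads "full order" as the gap closes — for EVERY exponent:** for any constant `g ≥ 0` (any
`α`, `g = 1/(2^α − 1)`, any `κ`), `C_g(hₐ) ≥ ½ − (1 + g)·B/hₐ` on the exact paramagnet data for all `B, hₐ > 0`; so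
`C_g → ½ = ō` (FULL saturation) as `B/hₐ → 0` with `m* = 0` throughout, and no choice of exponent repairs the rule
(pc-critic-3 §B′) — from `S(hₐ/2, hₐ) ≥ m(hₐ/2) ≥ ½(1 − 2B/hₐ)` and `S(2hₐ, 3hₐ) ≤ m(3hₐ) < ½`; the quantitative
form of the one-sidedness of finite-field data for the quasi-average. [cite: KomaTasaki1994, §2.5] -/
theorem chordRule_ge_of_nonneg {g B hₐ : ℝ} (hg : 0 ≤ g) (hB : 0 < B) (ha : 0 < hₐ) :
    1 / 2 - (1 + g) * (B / hₐ) ≤ chordRule g (energyDensity B) hₐ := by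
  rw [chordRule_energyDensity]
  have h1 : 1 / 2 * (1 - B / (hₐ / 2)) ≤ chord B (hₐ / 2) hₐ :=
    (response_ge hB.le (by positivity)).trans (response_le_chord B (by positivity) (by linarith))
  have h2 : chord B (2 * hₐ) (3 * hₐ) ≤ 1 / 2 :=
    ((chord_le_response B (by positivity) (by linarith)).trans (response_lt_half hB _).le)
  have e1 : 1 / 2 * (1 - B / (hₐ / 2)) = 1 / 2 - B / hₐ := by field_simp
  rw [e1] at h1
  nlinarith [mul_le_mul_of_nonneg_left h1 (by positivity : (0 : ℝ) ≤ 1 + g), mul_le_mul_of_nonneg_left h2 hg]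

/-- **Every exponent false-positives once the gap is small against the field:** for `g ≥ 0` and
`0 < B < hₐ/(2(1 + g))`, `C_g(hₐ) > 0` on the exact paramagnet data (`m* = 0`). [cite: KomaTasaki1994, §2.5] -/
theorem chordRule_pos_of_nonneg {g B hₐ : ℝ} (hg : 0 ≤ g) (hB : 0 < B) (ha : 0 < hₐ)
    (hBa : B < hₐ / (2 * (1 + g))) : 0 < chordRule g (energyDensity B) hₐ := by
  have h := chordRule_ge_of_nonneg hg hB ha
  have : (1 + g) * (B / hₐ) < 1 / 2 := by
    rw [lt_div_iff₀ (by positivity)] at hBa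
    rw [← mul_div_assoc, div_lt_iff₀ ha]
    linarith
  linarith

/-- **The `α = ½` rule reads "full order" as the gap closes:** `C_½(hₐ) ≥ ½ − (2 + √2)·B/hₐ` for all `B, hₐ > 0`
(`g = 1 + √2` in `chordRule_ge_of_nonneg`). [cite: KomaTasaki1994, §2.5] -/
theorem chordRule_ge {B hₐ : ℝ} (hB : 0 < B) (ha : 0 < hₐ) :
    1 / 2 - (2 + Real.sqrt 2) * (B / hₐ) ≤ chordRule goldstoneHalf (energyDensity B) hₐ := by
  have h := chordRule_ge_of_nonneg (g := goldstoneHalf) (by unfold goldstoneHalf; positivity) hB ha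
  rw [goldstoneHalf] at h ⊢
  linarith

/-- **FALSE POSITIVE (chord form, scale-free):** for every `hₐ > 0` and every gap `0 < B < hₐ/2` the `α = ½`
octave rule on the EXACT paramagnet energy chords is strictly positive, `C_½(hₐ) > 0`, although `m* = 0` —
`S(hₐ/2, hₐ) ≥ m(hₐ/2) = (hₐ/2)/(2√(B² + hₐ²/4)) > 1/(2√2)` for `B < hₐ/2`, `S(2hₐ, 3hₐ) < ½`, and
`(2 + √2)/(2√2) = (1 + √2)/2` (kill test k2 of the cell's card, as run by critic-1 / pc-critic-3; the extrapolation
protocol it certifies is print's). [cite: KomaTasaki1994, §2.5] -/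
theorem chordRule_pos {B hₐ : ℝ} (hB : 0 < B) (ha : 0 < hₐ) (hBa : B < hₐ / 2) :
    0 < chordRule goldstoneHalf (energyDensity B) hₐ := by
  rw [chordRule_energyDensity, goldstoneHalf]
  set s := Real.sqrt 2 with hsdef
  have hs2 : s ^ 2 = 2 := Real.sq_sqrt (by norm_num)
  have hs0 : 0 < s := Real.sqrt_pos.2 (by norm_num)
  -- `m(hₐ/2) > s/4`
  set r := Real.sqrt (B ^ 2 + (hₐ / 2) ^ 2) with hrdef
  have hr0 : 0 < r := Real.sqrt_pos.2 (by positivity)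
  have hr_lt : r < hₐ / s := by
    rw [hrdef, Real.sqrt_lt' (by positivity)]
    have e : (hₐ / s) ^ 2 = hₐ ^ 2 / 2 := by rw [div_pow, hs2]
    rw [e]
    nlinarith
  have hm : s / 4 < response B (hₐ / 2) := by
    rw [response, ← hrdef]
    have : hₐ / 2 / (2 * (hₐ / s)) < hₐ / 2 / (2 * r) :=
      div_lt_div_of_pos_left (by positivity) (by positivity) (by linarith)
    have e : hₐ / 2 / (2 * (hₐ / s)) = s / 4 := by field_simp; ring
    linarith [e]
  have h1 : s / 4 < chord B (hₐ / 2) hₐ :=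
    hm.trans_le (response_le_chord B (by positivity) (by linarith))
  have h2 : chord B (2 * hₐ) (3 * hₐ) < 1 / 2 :=
    (chord_le_response B (by positivity) (by linarith)).trans_lt (response_lt_half hB _)
  -- `(2+s)·S₁ > (2+s)s/4 = (1+s)/2 > (1+s)·S₂`
  have h3 : (2 + s) * (s / 4) < (2 + s) * chord B (hₐ / 2) hₐ := mul_lt_mul_of_pos_left h1 (by positivity)
  have h4 : (1 + s) * chord B (2 * hₐ) (3 * hₐ) < (1 + s) * (1 / 2) := mul_lt_mul_of_pos_left h2 (by positivity)
  have e3 : (2 + s) * (s / 4) = (1 + s) * (1 / 2) := by nlinarith [hs2]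
  nlinarith [h3, h4, e3]

/-- **The verdict-table row `B/hₐ = ½`:** at `(B, hₐ) = (1, 2)` the rule gives `C_½ > 1/5` (exact value
`(2+√2)(√5−√2)/2 − (1+√2)(√37−√17)/4 = 0.2203…`; critic-1's table: `+0.220`), with `m* = 0`.
[cite: KomaTasaki1994, §2.5] -/
theorem chordRule_one_two : 1 / 5 < chordRule goldstoneHalf (energyDensity 1) 2 := by
  rw [chordRule_energyDensity, goldstoneHalf,
    chord_eq 1 (by norm_num : (2 : ℝ) / 2 ≠ 2), chord_eq 1 (by norm_num : (2 : ℝ) * 2 ≠ 3 * 2)]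
  have e1 : Real.sqrt (1 ^ 2 + (2 / 2) ^ 2) = Real.sqrt 2 := by norm_num
  have e2 : Real.sqrt (1 ^ 2 + 2 ^ 2) = Real.sqrt 5 := by norm_num
  have e3 : Real.sqrt (1 ^ 2 + (2 * 2) ^ 2) = Real.sqrt 17 := by norm_num
  have e4 : Real.sqrt (1 ^ 2 + (3 * 2) ^ 2) = Real.sqrt 37 := by norm_num
  rw [e1, e2, e3, e4]
  obtain ⟨s2l, s2u⟩ := sqrt_two_bounds
  have s5l : (2.23606 : ℝ) < Real.sqrt 5 := by rw [Real.lt_sqrt (by norm_num)]; norm_num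
  have s5u : Real.sqrt 5 < 2.23607 := by rw [Real.sqrt_lt' (by norm_num)]; norm_num
  have s17l : (4.12310 : ℝ) < Real.sqrt 17 := by rw [Real.lt_sqrt (by norm_num)]; norm_num
  have s37l : (6.08276 : ℝ) < Real.sqrt 37 := by rw [Real.lt_sqrt (by norm_num)]; norm_num
  -- first term ≥ (2+√2)·3/(2(√2+√5)), second term ≤ (1+√2)·10/(2(√17+√37))
  have hA : (0.4109 : ℝ) < (2 / 2 + 2) / (2 * (Real.sqrt 2 + Real.sqrt 5)) := by
    rw [lt_div_iff₀ (by positivity)]; nlinarith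
  have hB : (2 * 2 + 3 * 2) / (2 * (Real.sqrt 17 + Real.sqrt 37)) < (0.48993 : ℝ) := by
    rw [div_lt_iff₀ (by positivity)]; nlinarith
  have h1 : (1 + (1 + Real.sqrt 2)) * 0.4109 < (1 + (1 + Real.sqrt 2)) * ((2 / 2 + 2) / (2 * (Real.sqrt 2 + Real.sqrt 5))) :=
    mul_lt_mul_of_pos_left hA (by positivity)
  have h2 : (1 + Real.sqrt 2) * ((2 * 2 + 3 * 2) / (2 * (Real.sqrt 17 + Real.sqrt 37))) < (1 + Real.sqrt 2) * 0.48993 :=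
    mul_lt_mul_of_pos_left hB (by positivity)
  nlinarith [h1, h2, s2l, s2u]

/-- **Point form, every exponent:** for `g ≥ 0` and `B, hₐ > 0`, on the exact paramagnet response
`P_g(hₐ) = (1+g)·m(hₐ) − g·m(2hₐ) > 0 ↔ 4g²(B² + hₐ²) < (1+g)²(B² + 4hₐ²)` (cross-multiplication and squaring of
`2g·√(B²+hₐ²) < (1+g)·√(B²+4hₐ²)`); in particular `P_g > 0` for EVERY `B` when `g ≤ 1`, and for `g > 1` iff
`(B/hₐ)² < 4(1+2g)/((3g+1)(g−1))` (pc-critic-3 §B). [cite: KomaTasaki1994, §2.5] -/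
theorem pointRule_pos_iff_sq {g B hₐ : ℝ} (hg : 0 ≤ g) (hB : 0 < B) (ha : 0 < hₐ) :
    0 < pointRule g (response B) hₐ ↔ 4 * g ^ 2 * (B ^ 2 + hₐ ^ 2) < (1 + g) ^ 2 * (B ^ 2 + 4 * hₐ ^ 2) := by
  rw [pointRule, response, response]
  set r1 := Real.sqrt (B ^ 2 + hₐ ^ 2) with hr1
  set r2 := Real.sqrt (B ^ 2 + (2 * hₐ) ^ 2) with hr2
  have hr1pos : 0 < r1 := Real.sqrt_pos.2 (by positivity)
  have hr2pos : 0 < r2 := Real.sqrt_pos.2 (by positivity)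
  have hr12 : r1 ^ 2 = B ^ 2 + hₐ ^ 2 := Real.sq_sqrt (by positivity)
  have hr22 : r2 ^ 2 = B ^ 2 + (2 * hₐ) ^ 2 := Real.sq_sqrt (by positivity)
  -- `P > 0 ↔ 2g·r1 < (1+g)·r2` (cross-multiply)
  have eq1 : g * (2 * hₐ) * (2 * r1) = (2 * hₐ) * (2 * g * r1) := by ring
  have eq2 : (1 + g) * hₐ * (2 * r2) = (2 * hₐ) * ((1 + g) * r2) := by ring
  have step1 : 0 < (1 + g) * (hₐ / (2 * r1)) - g * (2 * hₐ / (2 * r2)) ↔ 2 * g * r1 < (1 + g) * r2 := by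
    rw [sub_pos, ← mul_div_assoc, ← mul_div_assoc, div_lt_div_iff₀ (by positivity) (by positivity), eq1, eq2,
      mul_lt_mul_iff_right₀ (by positivity)]
  -- `… ↔ (2g r1)² < ((1+g) r2)²` (both sides nonnegative)
  have step2 : 2 * g * r1 < (1 + g) * r2 ↔ (2 * g * r1) ^ 2 < ((1 + g) * r2) ^ 2 :=
    (pow_lt_pow_iff_left₀ (by positivity) (by positivity) two_ne_zero).symm
  have e3 : (2 * g * r1) ^ 2 = 4 * g ^ 2 * (B ^ 2 + hₐ ^ 2) := by rw [mul_pow, hr12]; ring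
  have e4 : ((1 + g) * r2) ^ 2 = (1 + g) ^ 2 * (B ^ 2 + 4 * hₐ ^ 2) := by rw [mul_pow, hr22]; ring
  rw [step1, step2, e3, e4]

/-- **FALSE POSITIVE (point form, `α = ½`) with the exact threshold:** on the exact paramagnet response,
`P_½(hₐ) = (2+√2)·m(hₐ) − (1+√2)·m(2hₐ) > 0 ↔ B < √2·hₐ` (`B, hₐ > 0`), although `m* = 0` for every `B > 0`
(pc-critic-3 §B: `P > 0 ⇔ (B/hₐ)² < 2`; the point form is the Richardson-`½` member of print's fit family;
`4(1+√2)² = 2(2+√2)²`). [cite: KomaTasaki1994, §2.5] -/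
theorem pointRule_pos_iff {B hₐ : ℝ} (hB : 0 < B) (ha : 0 < hₐ) :
    0 < pointRule goldstoneHalf (response B) hₐ ↔ B < Real.sqrt 2 * hₐ := by
  have hg : (0 : ℝ) ≤ goldstoneHalf := by unfold goldstoneHalf; positivity
  rw [pointRule_pos_iff_sq hg hB ha, goldstoneHalf]
  set s := Real.sqrt 2 with hsdef
  have hs2 : s ^ 2 = 2 := Real.sq_sqrt (by norm_num)
  have hs0 : 0 < s := Real.sqrt_pos.2 (by norm_num)
  -- `4(1+s)² = 2c`, `(2+s)² = c` with `c = 6 + 4s > 0`; the inequality is `2c(B²+hₐ²) < c(B²+4hₐ²)`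
  have e1 : 4 * (1 + s) ^ 2 = 2 * (6 + 4 * s) := by linear_combination (4 : ℝ) * hs2
  have e2 : (1 + (1 + s)) ^ 2 = 6 + 4 * s := by linear_combination hs2
  rw [e1, e2]
  have hc : 0 < 6 + 4 * s := by positivity
  constructor
  · intro h
    have h' : B ^ 2 < (s * hₐ) ^ 2 := by rw [mul_pow, hs2]; nlinarith
    exact lt_of_pow_lt_pow_left₀ 2 (by positivity) h'
  · intro h
    have h' : B ^ 2 < (s * hₐ) ^ 2 := by gcongr
    rw [mul_pow, hs2] at h'
    nlinarith

end OctaveExtrapolation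

/-! ### §3  The barrier -/

open GappedParamagnet OctaveExtrapolation VanishingFieldSpins
open Literature.MathematicalPhysics.QuantumLattice.KomaTasaki
open Literature.MathematicalPhysics.QuantumLattice.GappedParamagnetExact

/-- **BARRIER `SqrtFieldExtrapolationFalsePositive` (relative-octave / `√h` extrapolation of sourced data is
stiffness-blind).**  For every field `hₐ > 0` and every `0 < B < hₐ/2`, for EVERY volume `N ≥ 1` there is a
Koma–Tasaki `U(1)` system on `N` spins `½` — the gapped paramagnet `paramagnet N B`, translation-invariant,
on-site, with volume-INDEPENDENT constants `r = 2`, `o = ½`, `h̄ = B/2` — such that: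
(a) NO ORDER: the symmetric Hamiltonian has a unique ground state `e` with spectral gap `B` and
`⟨e, (O^{(1)})² e⟩ = N/4 = o²N` (no LRO); sourced ground states of `H − hO^{(1)}` exist at every field, and every one
of them has energy EXACTLY `N·e(B, h) = −(N/2)√(B² + h²)` and response EXACTLY `N·m(B, h) = N h/(2√(B² + h²))`,
with `0 ≤ m(B, h) ≤ h/(2B)` for `h > 0` — so the field-then-volume order parameter `m* = lim_{h↓0} lim_N m` is ZERO;
(b) FALSE POSITIVE: on these exact (certified-grade) data the `α = ½` relative-octave extrapolation rule of the
cell's card `ktx-relative-octave-extrapolation` is strictly positive in both forms, `C_½(hₐ) > 0` and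
`P_½(hₐ) > 0`, and `C_½(hₐ) ≥ ½ − (2 + √2)·B/hₐ` ("certifies" full saturation `ō = ½` as `B/hₐ → 0`); and for
EVERY exponent (`g ≥ 0`) the chord rule reads `C_g(hₐ) ≥ ½ − (1 + g)·B/hₐ` — no choice of `α` repairs it.
Hence no implication "certified sourced chords/responses at fields `≥ hₐ/2` + an `h → 0⁺` extrapolation rule with
a relative (octave / Goldstone-exponent) regularity hypothesis ⇒ floor on `m*` or on LRO" holds over any class of
`U(1)` systems containing the gapped paramagnets; such a rule is sound exactly on the states where its hypothesis
holds, and data above `hₐ/2` cannot tell whether it does.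

technique_class: pinning-field symmetry-breaking-field finite-field-response quasi-average extrapolation-in-field Richardson-extrapolation Goldstone-exponent scaling-hypothesis-extrapolation sourced-chord-concavity relative-octave-modulus gapped-paramagnet Koma-Tasaki-converse
blocks: "certified sourced data at finitely many fields `h ≥ hₐ/2` + relative-octave / `√h` / Richardson / polynomial extrapolation `h → 0⁺` ⇒ FLOOR on the quasi-average `m*` or on LRO" as a transfer principle over `U(1)` systems with uniform Koma–Tasaki constants, translation invariance, volume-independent on-site interactions, unique gapped symmetric ground states (cell `hubbard-cq` census (23), pc-critic-3 KILL-KIT v0.2 W10 (v0.1: W9); LADDER row PC-a door E1a `Q-h`).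
because: the gapped paramagnet with `0 < B < hₐ/2` has `m* = 0`, no LRO, exact sourced data `e = −½√(B²+h²)`, `m = h/(2√(B²+h²))` at every volume, and `C_½(hₐ) > 0`, `C_½ ≥ ½ − (2+√2)B/hₐ`, `P_½(hₐ) > 0` (iff `B < √2 hₐ`), `C_g ≥ ½ − (1+g)B/hₐ` for every `g ≥ 0` — `SqrtFieldExtrapolationFalsePositive_holds`; finite-field data bound `m*` only from above [cite: KomaTasaki1994, §2.5].
evasions_known: absolute certified exclusion of a symmetric-phase uniform-mode gap `B < c·hₐ` (absence-side object; no energy-window producer); certified modulus of continuity of `m(h)` at `0⁺`; direct LRO proofs [cite: KennedyLiebShastry1988] with LRO ⇒ response [cite: KomaTasaki1994, Corollary 2.9]; filing extrapolated numbers as "extrapolated", never "certified" (print's fits [cite: QinEtAl2020, §III] [cite: XuEtAl2024, §III.B]).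
scope_caveats: a statement about the RULE over a class, not about the Hubbard model; thresholds formalised: `B < hₐ/2` (chord, sufficient; numerically `0.806 hₐ`), `B/hₐ = ½` (`chordRule_one_two`), `√2 hₐ` (point, exact); the ordered-side power defect (internal-field scale) is not formalised.
status: established (theorem `SqrtFieldExtrapolationFalsePositive_holds`).
[cite: KomaTasaki1994, §1 and §2.5] -/
def SqrtFieldExtrapolationFalsePositive : Prop :=
  ∀ hₐ : ℝ, 0 < hₐ → ∀ B : ℝ, 0 < B → B < hₐ / 2 → ∀ N : ℕ, 1 ≤ N →
    ∃ sys : U1System (Fin N) (Spins N),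
      -- volume-independent Koma–Tasaki constants, on-site supports
      sys.r = 2 ∧ sys.obar = 1 / 2 ∧ sys.hbar = B / 2 ∧ (∀ x, sys.supp x = {x}) ∧
      -- (a) no order: unique gapped symmetric ground state `e`, no LRO
      (∃ e : Spins N, ‖e‖ = 1 ∧ sys.hamiltonian e = ((-(B * N / 2) : ℝ) : ℂ) • e ∧
        (∀ ψ : Spins N, -(B * N / 2) * ‖ψ‖ ^ 2 ≤ (⟪ψ, sys.hamiltonian ψ⟫_ℂ).re) ∧
        (∀ g : Spins N, sys.hamiltonian g = ((-(B * N / 2) : ℝ) : ℂ) • g → g = ⟪e, g⟫_ℂ • e) ∧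
        (∀ ψ : Spins N, ⟪e, ψ⟫_ℂ = 0 → (-(B * N / 2) + B) * ‖ψ‖ ^ 2 ≤ (⟪ψ, sys.hamiltonian ψ⟫_ℂ).re) ∧
        ⟪e, sys.order 0 (sys.order 0 e)⟫_ℂ = (N : ℂ) / 4) ∧
      --     sourced ground states exist at every field …
      (∀ h : ℝ, ∃ Φ : Spins N, ‖Φ‖ = 1 ∧
        ∀ ψ : Spins N, ‖ψ‖ = 1 → (⟪Φ, (sys.hamiltonian - (h : ℂ) • sys.order 0) Φ⟫_ℂ).re ≤
          (⟪ψ, (sys.hamiltonian - (h : ℂ) • sys.order 0) ψ⟫_ℂ).re) ∧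
      --     … and every one of them has EXACTLY the energy `N·e(B,h)` and the response `N·m(B,h)`
      (∀ h : ℝ, ∀ Φ : Spins N, ‖Φ‖ = 1 →
        (∀ ψ : Spins N, ‖ψ‖ = 1 → (⟪Φ, (sys.hamiltonian - (h : ℂ) • sys.order 0) Φ⟫_ℂ).re ≤
          (⟪ψ, (sys.hamiltonian - (h : ℂ) • sys.order 0) ψ⟫_ℂ).re) →
        (⟪Φ, (sys.hamiltonian - (h : ℂ) • sys.order 0) Φ⟫_ℂ).re = N * energyDensity B h ∧
        (⟪Φ, sys.order 0 Φ⟫_ℂ).re = N * response B h) ∧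
      --     the response vanishes linearly with the field: `m* = 0`
      (∀ h : ℝ, 0 < h → 0 ≤ response B h ∧ response B h ≤ h / (2 * B)) ∧
      -- (b) the `α = ½` octave rule on these exact data is strictly positive (false positive)
      0 < chordRule goldstoneHalf (energyDensity B) hₐ ∧
      1 / 2 - (2 + Real.sqrt 2) * (B / hₐ) ≤ chordRule goldstoneHalf (energyDensity B) hₐ ∧
      0 < pointRule goldstoneHalf (response B) hₐ ∧
      --     and no exponent repairs it: for EVERY `g ≥ 0` the chord rule reads at least `½ − (1+g)B/hₐ`
      (∀ g : ℝ, 0 ≤ g → 1 / 2 - (1 + g) * (B / hₐ) ≤ chordRule g (energyDensity B) hₐ)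

/-- **`SqrtFieldExtrapolationFalsePositive` holds** — witnessed by `GappedParamagnet.paramagnet N B`; clause (a) is
`paramagnet_profile` + `gs_energy_eq` + `gs_response_eq` + `response_le`, clause (b) is `chordRule_pos`,
`chordRule_ge`, `pointRule_pos_iff`. [cite: KomaTasaki1994, §1 and §2.5] -/
theorem SqrtFieldExtrapolationFalsePositive_holds : SqrtFieldExtrapolationFalsePositive := by
  intro hₐ ha B hB hBa N hN
  refine ⟨paramagnet N B, rfl, rfl, by simp [paramagnet, abs_of_pos hB], fun x => rfl, ?_, ?_, ?_, ?_,
    chordRule_pos hB ha hBa, chordRule_ge hB ha, ?_, fun g hg => chordRule_ge_of_nonneg hg hB ha⟩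
  · -- (a) symmetric floor
    obtain ⟨_, _, _, _, hE, hdown, hnorm, huniq, hgap, hlro, -⟩ := paramagnet_profile N hB
    refine ⟨basisVec down, hnorm, hdown, hE, huniq, hgap, ?_⟩
    have := hlro (basisVec down) hdown
    rw [this, hnorm]
    push_cast
    ring
  · -- existence of sourced ground states
    intro h
    obtain ⟨-, -, -, -, -, -, -, -, -, -, hex, -⟩ := paramagnet_profile N hB
    obtain ⟨Φ, hΦ⟩ := hex h
    exact ⟨Φ, hΦ.1, hΦ.2⟩
  · -- exact energy and response of every sourced ground state
    intro h Φ hΦ1 hΦ2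
    have hΦ : IsVariationalGS (sourced N B h) Φ := ⟨hΦ1, hΦ2⟩
    exact ⟨gs_energy_eq_mul_energyDensity hB h hΦ, gs_response_eq_mul_response hB h hΦ⟩
  · -- `m* = 0`
    intro h hh
    exact ⟨response_nonneg B hh.le, response_le hB hh.le⟩
  · -- point form: `B < hₐ/2 < √2 hₐ`
    refine (pointRule_pos_iff hB ha).2 (hBa.trans ?_)
    have : (1 : ℝ) < Real.sqrt 2 := by
      rw [show (1 : ℝ) = Real.sqrt 1 by simp]
      exact Real.sqrt_lt_sqrt (by norm_num) (by norm_num)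
    nlinarith

/-- **The existential form asked for by the cell** (lead ASSIGN 2026-08-26T18:50Z): there are `B, hₐ > 0` with
`C_½(B; hₐ) > 0` (indeed `> 1/5`, at `B/hₐ = ½`) and `P_½(B; hₐ) > 0` while the order parameter of the system
producing the data is zero: `m(B, h) → 0` as `h → 0`, `m(B, h) ≤ h/(2B)`, and at every volume every sourced ground
state of `paramagnet N B` has exactly the energy `N·e(B, h)` and the response `N·m(B, h)` entering the rule.
[cite: KomaTasaki1994, §1 and §2.5] -/
theorem sqrtExtrapolation_false_positive :
    ∃ B hₐ : ℝ, 0 < B ∧ 0 < hₐ ∧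
      1 / 5 < chordRule goldstoneHalf (energyDensity B) hₐ ∧
      0 < pointRule goldstoneHalf (response B) hₐ ∧
      Filter.Tendsto (response B) (nhds 0) (nhds 0) ∧
      (∀ h : ℝ, 0 < h → response B h ≤ h / (2 * B)) ∧
      (∀ N : ℕ, ∀ h : ℝ, ∀ Φ : Spins N, IsVariationalGS (sourced N B h) Φ →
        (⟪Φ, sourced N B h Φ⟫_ℂ).re = N * energyDensity B h ∧
        (⟪Φ, (paramagnet N B).order 0 Φ⟫_ℂ).re = N * response B h) := by
  refine ⟨1, 2, one_pos, two_pos, chordRule_one_two, ?_, tendsto_response_zero one_ne_zero,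
    fun h hh => response_le one_pos hh.le, fun N h Φ hΦ => ?_⟩
  · refine (pointRule_pos_iff one_pos two_pos).2 ?_
    have : (1 : ℝ) < Real.sqrt 2 := by
      rw [show (1 : ℝ) = Real.sqrt 1 by simp]
      exact Real.sqrt_lt_sqrt (by norm_num) (by norm_num)
    nlinarith
  · exact ⟨gs_energy_eq_mul_energyDensity one_pos h hΦ, gs_response_eq_mul_response one_pos h hΦ⟩

end Literature.Barriers.HubbardSuperconductivity
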